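import Literature.NumberTheory.Sieve.PolymathGEHWindowStraddle
import Literature.NumberTheory.Sieve.PolymathGEHPiecesUniform
import Literature.NumberTheory.Sieve.PolymathGEHFamilies
import HarnessLib

/-!
# Proposition 2.7 (`GEH ⟹ EH`): the parameters and the `GEH` family of Type II pieces

Trunk AntSieve, tooling toward the named fact `Literature.NumberTheory.Sieve.weakDHL_three_two_of_GEH`
(D. H. J. Polymath, Res. Math. Sci. 1:12 (2014) = arXiv:1407.4897, Theorem 3.2(xii)).  Choice of the
parameters of the decomposition at the point `X` (files `PolymathGEHWindowDecomp`, `-Pieces`, `-Straddle`):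
`δ = 1 / max(3, (log X)^{B₀})`, `ρ = 1 + δ ∈ (1, 4/3]`, `S = ⌈2 log X / δ⌉` (so that `ρ^{S+1} ≥ X`),
`U = V = ⌊X^{ε₁}⌋`; and the finite family, indexed by `j < 2(S+1)²` (a flag and a pair `(s, t)`), of
`GEH` data `(N, M, α, β) = (⌊ρ^s⌋, m_t, α_s or |α_s|, β_t)` for the RELEVANT pairs (`relevant`: the
pieces are nonzero, the product range meets the window, and the blocks sit inside `[N, 2N]`,
`[M, 2M]`), dummy zero data otherwise.  The main result `gehFamily_bound` feeds this family to
`GeneralizedElliottHalberstam.finite_family` (hypotheses (2.3)–(2.4) of Claim 2.6: ranges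
`X^{ε₁/2} ≤ N, M ≤ X^{1−ε₁/2}`, `NM ≍ X`, supports, divisor bounds `|a| ≤ τ`, `Λ ≤ log`, and the
Siegel–Walfisz hypothesis for the `β`-pieces from `vonMangoldtPiece_siegelWalfisz_uniform`) and returns
a uniform bound `C X (log X)^{-A}` for the discrepancy sums `gehSum` of every member.

## References

* [Polymath8b2014] D. H. J. Polymath, Res. Math. Sci. 1 (2014), Art. 12 = arXiv:1407.4897,
  Claim 2.6, Proposition 2.7 (pp. 6–7).
-/

noncomputable section

open Finset Real Filter
open scoped ArithmeticFunction.Moebius ArithmeticFunction.vonMangoldt ArithmeticFunction.sigma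

namespace Literature.NumberTheory.Sieve

open BFI (absAF absAF_apply)

namespace GEHtoEH

/-! ### Parameters -/

/-- `δ(X) = 1 / max(3, (log X)^{B₀}) ∈ (0, 1/3]`. [folklore] -/
def delta (B₀ X : ℝ) : ℝ := 1 / max 3 (Real.log X ^ B₀)

/-- `ρ(X) = 1 + δ(X)`. [cite: Polymath8b2014, Proposition 2.7] -/
def rho (B₀ X : ℝ) : ℝ := 1 + delta B₀ X

/-- `S(X) = ⌈2 log X / δ(X)⌉`, the number of grid steps. [folklore] -/
def Sidx (B₀ X : ℝ) : ℕ := ⌈2 * Real.log X / delta B₀ X⌉₊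

/-- `U(X) = V(X) = ⌊X^{ε₁}⌋`. [cite: Polymath8b2014, Proposition 2.7] -/
def Ucut (ε₁ X : ℝ) : ℕ := ⌊X ^ ε₁⌋₊

/-- `δ > 0`. [folklore] -/
theorem delta_pos (B₀ X : ℝ) : 0 < delta B₀ X := by
  unfold delta
  exact one_div_pos.2 (lt_of_lt_of_le (by norm_num) (le_max_left _ _))

/-- `δ ≤ 1/3`. [folklore] -/
theorem delta_le (B₀ X : ℝ) : delta B₀ X ≤ 1 / 3 := by
  unfold delta
  exact one_div_le_one_div_of_le (by norm_num) (le_max_left _ _)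

/-- `δ ≤ (log X)^{-B₀}`. [folklore] -/
theorem delta_le_inv_logpow (B₀ X : ℝ) (h : 0 < Real.log X ^ B₀) : delta B₀ X ≤ 1 / Real.log X ^ B₀ := by
  unfold delta
  exact one_div_le_one_div_of_le h (le_max_right _ _)

/-- `ρ ≥ 1`. [folklore] -/
theorem one_le_rho (B₀ X : ℝ) : 1 ≤ rho B₀ X := by
  unfold rho; linarith [delta_pos B₀ X]

/-- `ρ ≤ 4/3`. [folklore] -/
theorem rho_le (B₀ X : ℝ) : rho B₀ X ≤ 4 / 3 := by
  unfold rho; linarith [delta_le B₀ X]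

/-- `ρ > 0`. [folklore] -/
theorem rho_pos (B₀ X : ℝ) : 0 < rho B₀ X := by linarith [one_le_rho B₀ X]

/-- `log ρ ≥ δ/2`. [folklore] -/
theorem delta_div_two_le_log_rho (B₀ X : ℝ) : delta B₀ X / 2 ≤ Real.log (rho B₀ X) := by
  have hδ := delta_pos B₀ X
  have hδ1 := delta_le B₀ X
  -- `log(1+δ) = -log(1/(1+δ)) ≥ -(1/(1+δ) - 1) = δ/(1+δ) ≥ δ/2`
  have h1 : Real.log (1 / (1 + delta B₀ X)) ≤ 1 / (1 + delta B₀ X) - 1 :=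
    Real.log_le_sub_one_of_pos (by positivity)
  rw [Real.log_div (by norm_num) (by linarith), Real.log_one, zero_sub] at h1
  unfold rho
  have h2 : delta B₀ X / 2 ≤ 1 - 1 / (1 + delta B₀ X) := by
    have e : 1 - 1 / (1 + delta B₀ X) = delta B₀ X / (1 + delta B₀ X) := by
      field_simp
      ring
    rw [e, div_le_div_iff₀ (by norm_num : (0:ℝ) < 2) (by linarith : (0:ℝ) < 1 + delta B₀ X)]
    nlinarith
  linarith

/-- `ρ^{S+1} ≥ X` for `X ≥ 1`. [folklore] -/
theorem le_rho_pow_Sidx_succ (B₀ : ℝ) {X : ℝ} (hX : 1 ≤ X) : X ≤ rho B₀ X ^ (Sidx B₀ X + 1) := by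
  have hρ := rho_pos B₀ X
  have hδ := delta_pos B₀ X
  rw [← Real.log_le_log_iff (by linarith : 0 < X) (pow_pos hρ _), Real.log_pow]
  have h1 := delta_div_two_le_log_rho B₀ X
  have h2 : 2 * Real.log X / delta B₀ X ≤ (Sidx B₀ X : ℝ) := Nat.le_ceil _
  have h3 : Real.log X ≤ (Sidx B₀ X : ℝ) * (delta B₀ X / 2) := by
    rw [div_le_iff₀ hδ] at h2
    linarith
  have h4 : 0 ≤ Real.log X := Real.log_nonneg hX
  calc Real.log X ≤ (Sidx B₀ X : ℝ) * (delta B₀ X / 2) := h3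
    _ ≤ ((Sidx B₀ X + 1 : ℕ) : ℝ) * Real.log (rho B₀ X) := by
        push_cast
        have : (0 : ℝ) ≤ Sidx B₀ X := Nat.cast_nonneg _
        nlinarith [h1, Real.log_nonneg (one_le_rho B₀ X)]

/-- `⌊X⌋ ≤ lo ρ (S+1)` for `X ≥ 1`. [folklore] -/
theorem floor_le_lo_Sidx_succ (B₀ : ℝ) {X : ℝ} (hX : 1 ≤ X) :
    ⌊X⌋₊ ≤ lo (rho B₀ X) (Sidx B₀ X + 1) := Nat.floor_le_floor (le_rho_pow_Sidx_succ B₀ hX)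

/-! ### The relevant pairs and the family -/

/-- The relevant pairs `(s, t)` at the point `X`. [folklore] -/
def Relevant (ε₁ B₀ X : ℝ) (s t : ℕ) : Prop :=
  Ucut ε₁ X < lo (rho B₀ X) (s + 1) ∧ Ucut ε₁ X < lo (rho B₀ X) (t + 1) ∧
  (lo (rho B₀ X) s + 1) * (mV (Ucut ε₁ X) (rho B₀ X) t + 1) ≤ ⌊X⌋₊ ∧
  ⌊X / 2⌋₊ < lo (rho B₀ X) (s + 1) * lo (rho B₀ X) (t + 1) ∧
  lo (rho B₀ X) (s + 1) ≤ 2 * lo (rho B₀ X) s ∧ lo (rho B₀ X) (t + 1) ≤ 2 * lo (rho B₀ X) t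

/-- Relevance is decidable (a conjunction of inequalities of naturals). [folklore] -/
instance (ε₁ B₀ X : ℝ) (s t : ℕ) : Decidable (Relevant ε₁ B₀ X s t) := by
  unfold Relevant; infer_instance

/-- Decoding of the family index: flag. [folklore] -/
def jflag (j : ℕ) : ℕ := j % 2
/-- Decoding of the family index: `s`. [folklore] -/
def js (B₀ X : ℝ) (j : ℕ) : ℕ := (j / 2) % (Sidx B₀ X + 1)
/-- Decoding of the family index: `t`. [folklore] -/
def jt (B₀ X : ℝ) (j : ℕ) : ℕ := (j / 2) / (Sidx B₀ X + 1)
/-- Encoding of `(flag, s, t)`. [folklore] -/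
def jenc (B₀ X : ℝ) (f s t : ℕ) : ℕ := 2 * (s + (Sidx B₀ X + 1) * t) + f
/-- The size of the family. [folklore] -/
def Jfam (B₀ X : ℝ) : ℕ := 2 * (Sidx B₀ X + 1) ^ 2

/-- Decoding the flag. [folklore] -/
theorem jflag_jenc (B₀ X : ℝ) {f : ℕ} (hf : f < 2) (s t : ℕ) : jflag (jenc B₀ X f s t) = f := by
  unfold jflag jenc; omega

/-- Decoding `s`. [folklore] -/
theorem js_jenc (B₀ X : ℝ) {f s : ℕ} (hf : f < 2) (hs : s < Sidx B₀ X + 1) (t : ℕ) :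
    js B₀ X (jenc B₀ X f s t) = s := by
  unfold js jenc
  have : (2 * (s + (Sidx B₀ X + 1) * t) + f) / 2 = s + (Sidx B₀ X + 1) * t := by omega
  rw [this, Nat.add_mul_mod_self_left, Nat.mod_eq_of_lt hs]

/-- Decoding `t`. [folklore] -/
theorem jt_jenc (B₀ X : ℝ) {f s : ℕ} (hf : f < 2) (hs : s < Sidx B₀ X + 1) (t : ℕ) :
    jt B₀ X (jenc B₀ X f s t) = t := by
  unfold jt jenc
  have : (2 * (s + (Sidx B₀ X + 1) * t) + f) / 2 = s + (Sidx B₀ X + 1) * t := by omega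
  rw [this, Nat.add_mul_div_left _ _ (Nat.succ_pos _), Nat.div_eq_of_lt hs, zero_add]

/-- Codes are below the family size. [folklore] -/
theorem jenc_lt (B₀ X : ℝ) {f s t : ℕ} (hf : f < 2) (hs : s < Sidx B₀ X + 1) (ht : t < Sidx B₀ X + 1) :
    jenc B₀ X f s t < Jfam B₀ X := by
  unfold jenc Jfam
  have : s + (Sidx B₀ X + 1) * t < (Sidx B₀ X + 1) ^ 2 := by
    calc s + (Sidx B₀ X + 1) * t < (Sidx B₀ X + 1) + (Sidx B₀ X + 1) * t := by omega
      _ = (Sidx B₀ X + 1) * (t + 1) := by ring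
      _ ≤ (Sidx B₀ X + 1) * (Sidx B₀ X + 1) := Nat.mul_le_mul_left _ ht
      _ = (Sidx B₀ X + 1) ^ 2 := (sq _).symm
  omega

/-- The family: scale `N` of the `α`-member. [folklore] -/
def Nfam (ε₁ B₀ : ℝ) (X : ℝ) (j : ℕ) : ℝ :=
  if Relevant ε₁ B₀ X (js B₀ X j) (jt B₀ X j) then (lo (rho B₀ X) (js B₀ X j) : ℝ) else Real.sqrt X

/-- The family: scale `M` of the `β`-member. [folklore] -/
def Mfam (ε₁ B₀ : ℝ) (X : ℝ) (j : ℕ) : ℝ :=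
  if Relevant ε₁ B₀ X (js B₀ X j) (jt B₀ X j) then (mV (Ucut ε₁ X) (rho B₀ X) (jt B₀ X j) : ℝ)
  else Real.sqrt X

/-- The family: the `α`-member (`α_s` or `|α_s|`). [folklore] -/
def αfam (ε₁ B₀ : ℝ) (X : ℝ) (j : ℕ) : ArithmeticFunction ℝ :=
  if Relevant ε₁ B₀ X (js B₀ X j) (jt B₀ X j) then
    (if jflag j = 0 then alphaPiece (Ucut ε₁ X) (rho B₀ X) (js B₀ X j)
      else absAF (alphaPiece (Ucut ε₁ X) (rho B₀ X) (js B₀ X j)))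
  else 0

/-- The family: the `β`-member `β_t`. [folklore] -/
def βfam (ε₁ B₀ : ℝ) (X : ℝ) (j : ℕ) : ArithmeticFunction ℝ :=
  if Relevant ε₁ B₀ X (js B₀ X j) (jt B₀ X j) then betaPiece (Ucut ε₁ X) (rho B₀ X) (jt B₀ X j) else 0

/-! ### Consequences of relevance (for `X` large) -/

section Bounds

variable {ε₁ B₀ X : ℝ} {s t : ℕ}

/-- `⌊X^{ε₁}⌋ + 1 > X^{ε₁}` and friends: the basic size facts at a large point `X`. [folklore] -/
private theorem basic_sizes (hX : 16 ≤ X) (hE : 4 ≤ X ^ (ε₁ / 2)) :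
    0 < X ∧ (1 : ℝ) ≤ X ∧ X ^ ε₁ = (X ^ (ε₁ / 2)) ^ 2 ∧ 16 ≤ X ^ ε₁ ∧
      (Ucut ε₁ X : ℝ) ≤ X ^ ε₁ ∧ X ^ ε₁ < (Ucut ε₁ X : ℝ) + 1 := by
  have hX0 : 0 < X := by linarith
  have hsq : X ^ ε₁ = (X ^ (ε₁ / 2)) ^ 2 := by
    rw [← Real.rpow_natCast, ← Real.rpow_mul hX0.le]; norm_num
  refine ⟨hX0, by linarith, hsq, ?_, Nat.floor_le (Real.rpow_nonneg hX0.le _), Nat.lt_floor_add_one _⟩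
  rw [hsq]; nlinarith

/-- If the `α`-piece `s` is not identically zero (`U < ⌊ρ^{s+1}⌋`) then `X^{ε₁/2} ≤ ⌊ρ^s⌋`
(`X ≥ 16`, `X^{ε₁/2} ≥ 4`). [folklore] -/
theorem rpow_le_lo_of_Ucut_lt (hX : 16 ≤ X) (hE : 4 ≤ X ^ (ε₁ / 2)) {s : ℕ}
    (h1 : Ucut ε₁ X < lo (rho B₀ X) (s + 1)) : X ^ (ε₁ / 2) ≤ (lo (rho B₀ X) s : ℝ) := by
  obtain ⟨hX0, hX1, hsq, h16, hU, hU1⟩ := basic_sizes hX hE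
  have hρ43 := rho_le B₀ X
  have hρ0 := rho_pos B₀ X
  have a1 : X ^ ε₁ < rho B₀ X ^ (s + 1) := by
    have : ((Ucut ε₁ X + 1 : ℕ) : ℝ) ≤ (lo (rho B₀ X) (s + 1) : ℝ) := by exact_mod_cast h1
    push_cast at this
    exact lt_of_lt_of_le hU1 (this.trans (Nat.floor_le (pow_nonneg hρ0.le _)))
  have a2 : 3 / 4 * X ^ ε₁ < rho B₀ X ^ s := by
    rw [pow_succ] at a1
    have : rho B₀ X ^ s * rho B₀ X ≤ rho B₀ X ^ s * (4 / 3) :=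
      mul_le_mul_of_nonneg_left hρ43 (pow_nonneg hρ0.le _)
    nlinarith
  have a3 : rho B₀ X ^ s < (lo (rho B₀ X) s : ℝ) + 1 := Nat.lt_floor_add_one _
  rw [hsq] at a2
  nlinarith

/-- If the `α`-piece `s` is not identically zero then its block sits in `[⌊ρ^s⌋, 2⌊ρ^s⌋]`:
`⌊ρ^{s+1}⌋ ≤ 2 ⌊ρ^s⌋` (`X ≥ 16`, `X^{ε₁/2} ≥ 4`). [folklore] -/
theorem lo_succ_le_two_mul_of_Ucut_lt (hX : 16 ≤ X) (hE : 4 ≤ X ^ (ε₁ / 2)) {s : ℕ}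
    (h1 : Ucut ε₁ X < lo (rho B₀ X) (s + 1)) : lo (rho B₀ X) (s + 1) ≤ 2 * lo (rho B₀ X) s := by
  have hlo := rpow_le_lo_of_Ucut_lt hX hE h1
  have hρ43 := rho_le B₀ X
  have hρ0 := rho_pos B₀ X
  have h4 : (4 : ℝ) ≤ lo (rho B₀ X) s := hE.trans hlo
  have a1 : (lo (rho B₀ X) (s + 1) : ℝ) ≤ rho B₀ X * rho B₀ X ^ s := by
    rw [lo, ← pow_succ']; exact Nat.floor_le (pow_nonneg hρ0.le _)
  have a2 : rho B₀ X ^ s < (lo (rho B₀ X) s : ℝ) + 1 := Nat.lt_floor_add_one _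
  have a3 : (lo (rho B₀ X) (s + 1) : ℝ) < 2 * lo (rho B₀ X) s := by
    have : rho B₀ X * rho B₀ X ^ s ≤ 4 / 3 * rho B₀ X ^ s :=
      mul_le_mul_of_nonneg_right hρ43 (pow_nonneg hρ0.le _)
    nlinarith
  have : ((lo (rho B₀ X) (s + 1) : ℕ) : ℝ) < ((2 * lo (rho B₀ X) s : ℕ) : ℝ) := by push_cast; exact a3
  exact_mod_cast this.le

/-- For a relevant pair: `X^{ε₁/2} ≤ ⌊ρ^s⌋`. [folklore] -/
theorem Relevant.rpow_le_lo (hX : 16 ≤ X) (hE : 4 ≤ X ^ (ε₁ / 2))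
    (h : Relevant ε₁ B₀ X s t) : X ^ (ε₁ / 2) ≤ (lo (rho B₀ X) s : ℝ) :=
  rpow_le_lo_of_Ucut_lt hX hE h.1

/-- For a relevant pair: `X^{ε₁/2} ≤ m_t`. [folklore] -/
theorem Relevant.rpow_le_mV (hX : 16 ≤ X) (hE : 4 ≤ X ^ (ε₁ / 2))
    (h : Relevant ε₁ B₀ X s t) : X ^ (ε₁ / 2) ≤ (mV (Ucut ε₁ X) (rho B₀ X) t : ℝ) := by
  have a4 : (lo (rho B₀ X) t : ℝ) ≤ mV (Ucut ε₁ X) (rho B₀ X) t := by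
    rw [mV]; exact_mod_cast le_max_right _ _
  exact (rpow_le_lo_of_Ucut_lt hX hE h.2.1).trans a4

/-- For a relevant pair: `⌊ρ^s⌋ ≤ X^{1-ε₁/2}`. [folklore] -/
theorem Relevant.lo_le_rpow (hε : 0 < ε₁) (hX : 16 ≤ X) (hE : 4 ≤ X ^ (ε₁ / 2))
    (h : Relevant ε₁ B₀ X s t) : (lo (rho B₀ X) s : ℝ) ≤ X ^ (1 - ε₁ / 2) := by
  obtain ⟨hX0, hX1, hsq, h16, hU, hU1⟩ := basic_sizes hX hE
  obtain ⟨-, -, h3, -, -, -⟩ := h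
  -- `(lo s + 1)(mV t + 1) ≤ X` and `mV t + 1 > X^{ε₁}`
  have a1 : ((lo (rho B₀ X) s + 1 : ℕ) : ℝ) * ((mV (Ucut ε₁ X) (rho B₀ X) t + 1 : ℕ) : ℝ) ≤ X := by
    have : (((lo (rho B₀ X) s + 1) * (mV (Ucut ε₁ X) (rho B₀ X) t + 1) : ℕ) : ℝ) ≤ ⌊X⌋₊ := by
      exact_mod_cast h3
    push_cast at this ⊢
    exact this.trans (Nat.floor_le hX0.le)
  have a2 : X ^ ε₁ < ((mV (Ucut ε₁ X) (rho B₀ X) t + 1 : ℕ) : ℝ) := by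
    have : (Ucut ε₁ X : ℝ) ≤ mV (Ucut ε₁ X) (rho B₀ X) t := by rw [mV]; exact_mod_cast le_max_left _ _
    push_cast; linarith
  have hpos : 0 < X ^ ε₁ := Real.rpow_pos_of_pos hX0 _
  have a3 : ((lo (rho B₀ X) s + 1 : ℕ) : ℝ) * X ^ ε₁ ≤ X := by
    have h0 : (0 : ℝ) ≤ ((lo (rho B₀ X) s + 1 : ℕ) : ℝ) := Nat.cast_nonneg _
    nlinarith
  have a4 : (lo (rho B₀ X) s : ℝ) ≤ X / X ^ ε₁ := by
    rw [le_div_iff₀ hpos]; push_cast at a3; nlinarith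
  have a5 : X / X ^ ε₁ = X ^ (1 - ε₁) := by
    rw [Real.rpow_sub hX0, Real.rpow_one]
  rw [a5] at a4
  exact a4.trans (Real.rpow_le_rpow_of_exponent_le hX1 (by linarith))

/-- For a relevant pair: `m_t ≤ X^{1-ε₁/2}` and `⌊ρ^{t+1}⌋ ≤ X`. [folklore] -/
theorem Relevant.mV_le_rpow (hX : 16 ≤ X) (hE : 4 ≤ X ^ (ε₁ / 2))
    (h : Relevant ε₁ B₀ X s t) :
    (mV (Ucut ε₁ X) (rho B₀ X) t : ℝ) ≤ X ^ (1 - ε₁ / 2) ∧ (lo (rho B₀ X) (t + 1) : ℝ) ≤ X := by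
  obtain ⟨hX0, hX1, hsq, h16, hU, hU1⟩ := basic_sizes hX hE
  have hlo := h.rpow_le_lo hX hE
  obtain ⟨-, -, h3, -, -, h6⟩ := h
  have a1 : ((lo (rho B₀ X) s + 1 : ℕ) : ℝ) * ((mV (Ucut ε₁ X) (rho B₀ X) t + 1 : ℕ) : ℝ) ≤ X := by
    have : (((lo (rho B₀ X) s + 1) * (mV (Ucut ε₁ X) (rho B₀ X) t + 1) : ℕ) : ℝ) ≤ ⌊X⌋₊ := by
      exact_mod_cast h3
    push_cast at this ⊢
    exact this.trans (Nat.floor_le hX0.le)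
  have hEpos : 0 < X ^ (ε₁ / 2) := Real.rpow_pos_of_pos hX0 _
  push_cast at a1
  have a2 : (mV (Ucut ε₁ X) (rho B₀ X) t : ℝ) * X ^ (ε₁ / 2) ≤ X := by
    have h0 : (0 : ℝ) ≤ (mV (Ucut ε₁ X) (rho B₀ X) t : ℝ) := Nat.cast_nonneg _
    nlinarith
  have a3 : (mV (Ucut ε₁ X) (rho B₀ X) t : ℝ) ≤ X / X ^ (ε₁ / 2) := by rw [le_div_iff₀ hEpos]; exact a2
  have a4 : X / X ^ (ε₁ / 2) = X ^ (1 - ε₁ / 2) := by rw [Real.rpow_sub hX0, Real.rpow_one]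
  refine ⟨by rwa [a4] at a3, ?_⟩
  -- `lo(t+1) ≤ 2 lo t ≤ 2 mV t ≤ 2 X / X^{ε₁/2} ≤ X/2`
  have b1 : (lo (rho B₀ X) (t + 1) : ℝ) ≤ 2 * mV (Ucut ε₁ X) (rho B₀ X) t := by
    have : (lo (rho B₀ X) t : ℝ) ≤ mV (Ucut ε₁ X) (rho B₀ X) t := by rw [mV]; exact_mod_cast le_max_right _ _
    have h6' : (lo (rho B₀ X) (t + 1) : ℝ) ≤ 2 * lo (rho B₀ X) t := by exact_mod_cast h6
    linarith
  have b2 : 2 * (X / X ^ (ε₁ / 2)) ≤ X := by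
    rw [div_eq_mul_inv]
    have : (X ^ (ε₁ / 2))⁻¹ ≤ 1 / 4 := by rw [inv_le_comm₀ hEpos (by norm_num)]; linarith
    nlinarith
  linarith

/-- For a relevant pair: `X/16 ≤ ⌊ρ^s⌋ m_t ≤ 16 X`. [folklore] -/
theorem Relevant.prod_bounds (hX : 16 ≤ X) (hE : 4 ≤ X ^ (ε₁ / 2))
    (h : Relevant ε₁ B₀ X s t) :
    X / 16 ≤ (lo (rho B₀ X) s : ℝ) * mV (Ucut ε₁ X) (rho B₀ X) t ∧
      (lo (rho B₀ X) s : ℝ) * mV (Ucut ε₁ X) (rho B₀ X) t ≤ 16 * X := by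
  obtain ⟨hX0, hX1, -, -, -, -⟩ := basic_sizes hX hE
  obtain ⟨-, -, h3, h4, h5, h6⟩ := h
  constructor
  · have a1 : (⌊X / 2⌋₊ : ℝ) + 1 ≤ ((lo (rho B₀ X) (s + 1) * lo (rho B₀ X) (t + 1) : ℕ) : ℝ) := by
      exact_mod_cast h4
    have a2 : X / 2 < (⌊X / 2⌋₊ : ℝ) + 1 := Nat.lt_floor_add_one _
    have a3n : lo (rho B₀ X) (s + 1) * lo (rho B₀ X) (t + 1) ≤
        4 * (lo (rho B₀ X) s * mV (Ucut ε₁ X) (rho B₀ X) t) := by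
      have h6' : lo (rho B₀ X) (t + 1) ≤ 2 * mV (Ucut ε₁ X) (rho B₀ X) t :=
        h6.trans (Nat.mul_le_mul_left 2 (le_max_right _ _))
      calc lo (rho B₀ X) (s + 1) * lo (rho B₀ X) (t + 1)
          ≤ (2 * lo (rho B₀ X) s) * (2 * mV (Ucut ε₁ X) (rho B₀ X) t) := Nat.mul_le_mul h5 h6'
        _ = 4 * (lo (rho B₀ X) s * mV (Ucut ε₁ X) (rho B₀ X) t) := by ring
    have a3 : ((lo (rho B₀ X) (s + 1) * lo (rho B₀ X) (t + 1) : ℕ) : ℝ) ≤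
        4 * ((lo (rho B₀ X) s : ℝ) * mV (Ucut ε₁ X) (rho B₀ X) t) := by exact_mod_cast a3n
    linarith
  · have a1 : (((lo (rho B₀ X) s + 1) * (mV (Ucut ε₁ X) (rho B₀ X) t + 1) : ℕ) : ℝ) ≤ ⌊X⌋₊ := by
      exact_mod_cast h3
    push_cast at a1
    have a2 : (⌊X⌋₊ : ℝ) ≤ X := Nat.floor_le hX0.le
    have h0 : (0 : ℝ) ≤ lo (rho B₀ X) s := Nat.cast_nonneg _
    have h0' : (0 : ℝ) ≤ mV (Ucut ε₁ X) (rho B₀ X) t := Nat.cast_nonneg _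
    nlinarith

end Bounds

/-! ### The `GEH` bound for the family -/

/-- **`GEH[ϑ]` for the whole family of Type II pieces**: one constant `C` such that, eventually in
`X`, every member `j < 2(S+1)²` has discrepancy sum `gehSum ϑ 2 X N_j M_j α_j β_j ≤ C X (log X)^{-A}`.
[cite: Polymath8b2014, Claim 2.6 and Proposition 2.7] -/
theorem gehFamily_bound {ϑ : ℝ} (hGEH : GeneralizedElliottHalberstam ϑ) {ε₁ : ℝ} (hε : 0 < ε₁)
    (hε1 : ε₁ ≤ 1 / 2) (B₀ : ℝ) {A : ℝ} (hA : 0 < A) :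
    ∃ C : ℝ, ∀ᶠ X in atTop, ∀ j < Jfam B₀ X,
      gehSum ϑ 2 X (Nfam ε₁ B₀ X j) (Mfam ε₁ B₀ X j) (αfam ε₁ B₀ X j) (βfam ε₁ B₀ X j) ≤
        C * (X / Real.log X ^ A) := by
  have hε2 : 0 < ε₁ / 2 := by linarith
  -- eventual size conditions
  have eX : ∀ᶠ X : ℝ in atTop, 16 ≤ X := eventually_ge_atTop _
  have eE : ∀ᶠ X : ℝ in atTop, 4 ≤ X ^ (ε₁ / 2) := (tendsto_rpow_atTop hε2).eventually_ge_atTop _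
  have eL : ∀ᶠ X : ℝ in atTop, Real.exp 1 ≤ X := eventually_ge_atTop _
  refine GeneralizedElliottHalberstam.finite_family hGEH hε2 hA 1 (K := 2) (by norm_num) (Jfam B₀)
    (Eventually.of_forall fun X => by unfold Jfam; positivity)
    (Nfam ε₁ B₀) (Mfam ε₁ B₀) (αfam ε₁ B₀) (βfam ε₁ B₀) ?h1 ?h2 ?h3 ?h4 ?h5 ?h6
  case h1 =>
    filter_upwards [eX, eE] with X hX hE j _
    have hX0 : 0 < X := by linarith
    have hX1 : 1 ≤ X := by linarith
    unfold Nfam Mfam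
    by_cases hrel : Relevant ε₁ B₀ X (js B₀ X j) (jt B₀ X j)
    · rw [if_pos hrel, if_pos hrel]
      exact ⟨hrel.rpow_le_lo hX hE, hrel.lo_le_rpow hε hX hE, hrel.rpow_le_mV hX hE,
        (hrel.mV_le_rpow hX hE).1⟩
    · rw [if_neg hrel, if_neg hrel, Real.sqrt_eq_rpow]
      have l1 : X ^ (ε₁ / 2) ≤ X ^ (1 / 2 : ℝ) := Real.rpow_le_rpow_of_exponent_le hX1 (by linarith)
      have l2 : X ^ (1 / 2 : ℝ) ≤ X ^ (1 - ε₁ / 2) := Real.rpow_le_rpow_of_exponent_le hX1 (by linarith)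
      exact ⟨l1, l2, l1, l2⟩
  case h2 =>
    refine ⟨16, by norm_num, ?_⟩
    filter_upwards [eX, eE] with X hX hE j _
    have hX0 : 0 < X := by linarith
    unfold Nfam Mfam
    by_cases hrel : Relevant ε₁ B₀ X (js B₀ X j) (jt B₀ X j)
    · rw [if_pos hrel, if_pos hrel]
      exact hrel.prod_bounds hX hE
    · rw [if_neg hrel, if_neg hrel, Real.mul_self_sqrt hX0.le]
      constructor <;> linarith
  case h3 =>
    intro X j n hn
    unfold αfam
    unfold Nfam at hn
    by_cases hrel : Relevant ε₁ B₀ X (js B₀ X j) (jt B₀ X j)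
    · rw [if_pos hrel] at hn ⊢
      have hz : alphaPiece (Ucut ε₁ X) (rho B₀ X) (js B₀ X j) n = 0 := by
        refine alphaPiece_eq_zero ?_
        rcases hn with hn | hn
        · left; exact_mod_cast hn.le
        · right
          have h5 := hrel.2.2.2.2.1
          have : ((2 * lo (rho B₀ X) (js B₀ X j) : ℕ) : ℝ) < n := by push_cast; exact hn
          have : 2 * lo (rho B₀ X) (js B₀ X j) < n := by exact_mod_cast this
          omega
      split_ifs
      · exact hz
      · rw [absAF_apply, hz, abs_zero]
    · rw [if_neg hrel]; rfl
  case h4 =>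
    intro X j n hn
    unfold βfam
    unfold Mfam at hn
    by_cases hrel : Relevant ε₁ B₀ X (js B₀ X j) (jt B₀ X j)
    · rw [if_pos hrel] at hn ⊢
      refine betaPiece_eq_zero ?_
      rcases hn with hn | hn
      · left; exact_mod_cast hn.le
      · right
        have h6 := hrel.2.2.2.2.2
        have : ((2 * mV (Ucut ε₁ X) (rho B₀ X) (jt B₀ X j) : ℕ) : ℝ) < n := by push_cast; exact hn
        have : 2 * mV (Ucut ε₁ X) (rho B₀ X) (jt B₀ X j) < n := by exact_mod_cast this
        have : lo (rho B₀ X) (jt B₀ X j) ≤ mV (Ucut ε₁ X) (rho B₀ X) (jt B₀ X j) := le_max_right _ _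
        omega
    · rw [if_neg hrel]; rfl
  case h5 =>
    filter_upwards [eX, eE, eL] with X hX hE hL j _ n
    have hX0 : 0 < X := by linarith
    have hlog : 1 ≤ Real.log X := by rwa [Real.le_log_iff_exp_le hX0]
    simp only [pow_one]
    have hτ0 : (0 : ℝ) ≤ (σ 0 n : ℝ) := Nat.cast_nonneg _
    have hτ1 : n ≠ 0 → (1 : ℝ) ≤ (σ 0 n : ℝ) := fun hn => by
      have : 1 ≤ σ 0 n := by
        rw [ArithmeticFunction.sigma_zero_apply]
        exact Finset.card_pos.2 ⟨1, Nat.one_mem_divisors.2 hn⟩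
      exact_mod_cast this
    unfold αfam βfam
    by_cases hrel : Relevant ε₁ B₀ X (js B₀ X j) (jt B₀ X j)
    · rw [if_pos hrel, if_pos hrel]
      constructor
      · -- `|α| ≤ |a| ≤ τ ≤ τ log X`
        have ha : |alphaPiece (Ucut ε₁ X) (rho B₀ X) (js B₀ X j) n| ≤ (σ 0 n : ℝ) := by
          rw [alphaPiece_apply]
          split_ifs
          · exact abs_aFun_le _ _
          · rw [abs_zero]; exact hτ0
        have ha' : (σ 0 n : ℝ) ≤ (σ 0 n : ℝ) * Real.log X := le_mul_of_one_le_right hτ0 hlog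
        split_ifs
        · exact ha.trans ha'
        · rw [absAF_apply, abs_abs]; exact ha.trans ha'
      · -- `0 ≤ β ≤ Λ(n) ≤ log n ≤ log X ≤ τ(n) log X` on the support
        rw [abs_of_nonneg (betaPiece_nonneg _ _ _ _), betaPiece_apply]
        split_ifs with hc
        · have hn2 : (n : ℝ) ≤ X := by
            have := (hrel.mV_le_rpow hX hE).2
            have : (n : ℝ) ≤ lo (rho B₀ X) (jt B₀ X j + 1) := by exact_mod_cast hc.2
            linarith
          have hn0 : n ≠ 0 := by rintro rfl; exact absurd hc.1 (Nat.not_lt_zero _)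
          have hn1 : (0 : ℝ) < n := by exact_mod_cast Nat.pos_of_ne_zero hn0
          calc (Λ n : ℝ) ≤ Real.log n := ArithmeticFunction.vonMangoldt_le_log
            _ ≤ Real.log X := Real.log_le_log hn1 hn2
            _ ≤ (σ 0 n : ℝ) * Real.log X := le_mul_of_one_le_left (by linarith) (hτ1 hn0)
        · positivity
    · rw [if_neg hrel, if_neg hrel]
      simp only [ArithmeticFunction.zero_apply, abs_zero]
      exact ⟨by positivity, by positivity⟩
  case h6 =>
    intro B hB
    obtain ⟨Cu, hCu⟩ := vonMangoldtPiece_siegelWalfisz_uniform hε2 2 (by norm_num) 1 le_rfl B hB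
    refine ⟨max Cu 0, ?_⟩
    filter_upwards [hCu, eX, eE] with X hXu hX hE j _ q r hq hr a
    have hX0 : 0 < X := by linarith
    unfold βfam Mfam
    by_cases hrel : Relevant ε₁ B₀ X (js B₀ X j) (jt B₀ X j)
    · rw [if_pos hrel, if_pos hrel]
      have hm := hrel.rpow_le_mV hX hE
      have hm' := (hrel.mV_le_rpow hX hE).2
      have hmm' : mV (Ucut ε₁ X) (rho B₀ X) (jt B₀ X j) ≤ lo (rho B₀ X) (jt B₀ X j + 1) :=
        max_le hrel.2.1.le (lo_mono (one_le_rho B₀ X) (Nat.le_succ _))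
      have hK : (lo (rho B₀ X) (jt B₀ X j + 1) : ℝ) ≤ 2 * mV (Ucut ε₁ X) (rho B₀ X) (jt B₀ X j) := by
        have h6 := hrel.2.2.2.2.2
        have : (lo (rho B₀ X) (jt B₀ X j + 1) : ℝ) ≤ ((2 * lo (rho B₀ X) (jt B₀ X j) : ℕ) : ℝ) := by
          exact_mod_cast h6
        have h' : (lo (rho B₀ X) (jt B₀ X j) : ℝ) ≤ mV (Ucut ε₁ X) (rho B₀ X) (jt B₀ X j) := by
          exact_mod_cast le_max_right _ _
        push_cast at this; linarith
      have := hXu _ _ hm hmm' hK hm' q r hq hr a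
      rw [betaPiece]
      refine this.trans ?_
      have hnn : 0 ≤ (σ 0 (q * r) : ℝ) ^ 1 * (mV (Ucut ε₁ X) (rho B₀ X) (jt B₀ X j) : ℝ) / Real.log X ^ B := by
        have : 0 ≤ Real.log X := Real.log_nonneg (by linarith)
        positivity
      calc Cu * (σ 0 (q * r) : ℝ) ^ 1 * mV (Ucut ε₁ X) (rho B₀ X) (jt B₀ X j) / Real.log X ^ B
          = Cu * ((σ 0 (q * r) : ℝ) ^ 1 * mV (Ucut ε₁ X) (rho B₀ X) (jt B₀ X j) / Real.log X ^ B) := by ring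
        _ ≤ max Cu 0 * ((σ 0 (q * r) : ℝ) ^ 1 * mV (Ucut ε₁ X) (rho B₀ X) (jt B₀ X j) / Real.log X ^ B) :=
            mul_le_mul_of_nonneg_right (le_max_left _ _) hnn
        _ = _ := by ring
    · rw [if_neg hrel, if_neg hrel]
      have hz : apDiscrepancy (fun n => if n.Coprime r then (0 : ArithmeticFunction ℝ) n else 0)
          ⌊(2 : ℝ) * Real.sqrt X⌋₊ q a = 0 := by
        rw [apDiscrepancy_congr (γ₂ := fun _ => (0 : ℝ)) (fun n _ => by simp), apDiscrepancy_zero]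
      rw [hz, abs_zero]
      have : 0 ≤ Real.log X := Real.log_nonneg (by linarith)
      positivity

end GEHtoEH

end Literature.NumberTheory.Sieve
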